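import Literature.Geometry.Lorentzian.KerrStarMultiplierIdentity
import HarnessLib

/-!
# The Morawetz current `f(r*)∂_{r*} + ½f'` for axisymmetric waves on extremal Kerr in the
# coordinates `(t*, r, θ, φ*)`: profiles, and the bulk as a sum of three squares plus a
# zeroth-order term (physical-space form of the `X`-estimates of Aretakis, JFA 2012, §8)

(family `gr`; namespace `Literature.Geometry.Lorentzian.Kerr.StarCoord`; written from the proving
seat of `Literature.Barriers.FinalStateConjecture.Aretakis2012_integratedDecay` — Aretakis, JFA 263
(2012), Thms. 1–2 in shell form — which by
`ExtremalHorizonIntegratedDecayFromTransitionILED.lean` rests on one integrated local energy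
decay statement on a thin shell near `𝓗⁺`; the source proves integrated decay by currents
`J^{X}`, `X = f(r*)∂_{r*}`, applied mode by mode after separation (§§8–11). This file is the
physical-space algebra of such a current for AXISYMMETRIC functions, where no separation is
needed: on axisymmetric `ψ` one has `ρ²□_g ψ = ∂_r(Δ∂_rψ) − ((r²+a²)²/Δ)∂_t²ψ + 𝓛ψ` in
Boyer–Lindquist form with the Carter operator `𝓛 = Δ̸_θ + a² sin²θ ∂_t²` (§5.3 of the source),
which commutes with `∂_t, ∂_r` and has the non-negative form `∫(ψ_θ² + a² sin²θ ψ_t²)`.)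

For a radial seed `f = f(r)` put (extremal Kerr `a = M`, `Δ = (r − M)²`, `R² = r² + M²`)

* `mzProfileR M f r = f Δ/R²` (the `∂_r`-component), `mzProfileT M f r = 2Mr f/R²` (the
  `∂_{t*}`-component) — together the Boyer–Lindquist field `f ∂_{r*} = f (Δ/R²) ∂_r^{BL}`,
  `∂_r^{BL} = ∂_r + (2Mr/Δ)∂_{t*}` — and the Lagrangian coefficient
  `mzProfileW M f f₁ r = r f Δ/R⁴ + ½(Δ/R²) f₁` (`f₁ = f'`; this is `½∂_{r*}f` plus the term
  turning `ψ` into `u = Rψ`), all smooth on `ℝ` when `f` is and `M ≠ 0`.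

**Main identity** (`neg_multBulk_morawetz`): in the conventions of
`KerrStarMultiplierIdentity.lean` (`multBulk = −K ρ² sin θ`), for every `G` and every point,
`−multBulk = sin θ [ (f₁/R²)(Δ ∂_rG + 2Mr ∂_{t*}G)² + A(r)((∂_θG)² + M²(1 − cos²θ)(∂_{t*}G)²) + C(r) G² ]`
with `A = f (r − M)(r² − 2Mr − M²)/R⁴` (`= −½ f R² ∂_r(Δ/R⁴)`, vanishing at the effective photon
sphere `r = (1 + √2)M` of axisymmetric null geodesics, §1.2.2 of the source) and
`C = c_f f + c₁ f₁ + c₂ f₂ + c₃ f₃` (`f₂ = f''`, `f₃ = f'''`) with explicit rational coefficients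
(`mzZeroCoeff`): the first square is `f' (∂_{r*}u)²`, the second term `−½ f ∂_{r*}(Δ/R⁴)|Ðu|²`,
`|Ðu|² = u_θ² + M² sin²θ u_t²`, the third the zeroth-order term of the virial identity. Hence
(`neg_multBulk_morawetz_nonneg`) the bulk has a sign wherever `f₁ ≥ 0`, `A ≥ 0`, `C ≥ 0`. Also:
the horizon flux `F(t, M, θ) = 2M² f(M) sin θ (∂_{t*}G)²` (`multFluxR_morawetz_horizon`), signed by
`f(M)`.

Everything is proved (`ring`/`field_simp` from the definitions); no named facts.

## References

* S. Aretakis, *Decay of axisymmetric solutions of the wave equation on extreme Kerr backgrounds*,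
  J. Funct. Anal. 263 (2012) 2770–2831 (arXiv:1110.2006): §1.2.2 (the effective photon sphere
  `r = (1+√2)M`; integrated decay by classical currents in axisymmetry "remains an open problem"),
  §5.3 (the Carter operator), §8 (the currents `J^{X}`, `X = f(r*)∂_{r*}`) (key `Aretakis2012`).
* M. Dafermos, I. Rodnianski, *Lectures on black holes and linear waves*, arXiv:0811.0354, §4.1
  (the `X`-estimate on Schwarzschild with multiplier `f(r*)∂_{r*}` and the modification `½f'`)
  (key `DafermosRodnianski2008`).
-/

noncomputable section

open Real Set Filter
open scoped Topology ContDiff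

namespace Literature.Geometry.Lorentzian

namespace Kerr

namespace StarCoord

/-! ### The profiles -/

/-- The `∂_r`-component `f Δ/R²` of the Morawetz field `f ∂_{r*}` on extremal Kerr
(`Δ = (r − M)²`, `R² = r² + M²`). [cite: Aretakis2012, §8] -/
def mzProfileR (M : ℝ) (f : ℝ → ℝ) : ℝ → ℝ := fun r ↦ f r * (r - M) ^ 2 / (r ^ 2 + M ^ 2)

/-- The `∂_{t*}`-component `2Mr f/R²` of the Morawetz field `f ∂_{r*}` on extremal Kerr
(`∂_r^{BL} = ∂_r + (2Mr/Δ)∂_{t*}`). [cite: Aretakis2012, §8] -/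
def mzProfileT (M : ℝ) (f : ℝ → ℝ) : ℝ → ℝ := fun r ↦ 2 * M * r * f r / (r ^ 2 + M ^ 2)

/-- The Lagrangian coefficient `r f Δ/R⁴ + ½ (Δ/R²) f'` of the Morawetz current (`f₁ = f'`).
[cite: Aretakis2012, §8] -/
def mzProfileW (M : ℝ) (f f₁ : ℝ → ℝ) : ℝ → ℝ := fun r ↦
  r * f r * (r - M) ^ 2 / (r ^ 2 + M ^ 2) ^ 2 + 1 / 2 * ((r - M) ^ 2 / (r ^ 2 + M ^ 2) * f₁ r)

/-- The angular coefficient `A = f (r − M)(r² − 2Mr − M²)/R⁴ = −½ f R² ∂_r(Δ/R⁴)` of the Morawetz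
bulk (vanishing at `r = M` and at the effective photon sphere `r = (1 + √2)M`).
[cite: Aretakis2012, §1.2.2 and §8] -/
def mzAngCoeff (M : ℝ) (f : ℝ → ℝ) : ℝ → ℝ := fun r ↦
  f r * (r - M) * (r ^ 2 - 2 * M * r - M ^ 2) / (r ^ 2 + M ^ 2) ^ 2

/-- The zeroth-order coefficient `C = c_f f + c₁ f' + c₂ f'' + c₃ f'''` of the Morawetz bulk:
`c_f = 3M(r−M)²(r⁴−6M²r²+M⁴)/R⁸`, `c₁ = −M(r−M)²(3r³+2Mr²−M²r+2M³)/R⁶`,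
`c₂ = −(r−M)³(2r²+Mr+3M²)/(2R⁴)`, `c₃ = −(r−M)⁴/(4R²)`. [cite: Aretakis2012, §8] -/
def mzZeroCoeff (M : ℝ) (f f₁ f₂ f₃ : ℝ → ℝ) : ℝ → ℝ := fun r ↦
  3 * M * (r - M) ^ 2 * (r ^ 4 - 6 * M ^ 2 * r ^ 2 + M ^ 4) / (r ^ 2 + M ^ 2) ^ 4 * f r -
    M * (r - M) ^ 2 * (3 * r ^ 3 + 2 * M * r ^ 2 - M ^ 2 * r + 2 * M ^ 3) / (r ^ 2 + M ^ 2) ^ 3 * f₁ r -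
    (r - M) ^ 3 * (2 * r ^ 2 + M * r + 3 * M ^ 2) / (2 * (r ^ 2 + M ^ 2) ^ 2) * f₂ r -
    (r - M) ^ 4 / (4 * (r ^ 2 + M ^ 2)) * f₃ r

/-! ### Derivatives of the profiles -/

section Derivatives

variable {M : ℝ} {f f₁ f₂ f₃ : ℝ → ℝ}

/-- `R² = r² + M² > 0` for `M ≠ 0`. [folklore] -/
theorem R2_pos (hM : M ≠ 0) (r : ℝ) : 0 < r ^ 2 + M ^ 2 := by positivity

/-- `Δ' = 2(r − M)` (`Δ = (r − M)²`). [folklore] -/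
theorem hasDerivAt_Delta (M r : ℝ) : HasDerivAt (fun x : ℝ ↦ (x - M) ^ 2) (2 * (r - M)) r := by
  have h := ((hasDerivAt_id' r).sub_const M).fun_pow 2
  simpa using h

/-- `(R²)' = 2r`. [folklore] -/
theorem hasDerivAt_R2 (M r : ℝ) : HasDerivAt (fun x : ℝ ↦ x ^ 2 + M ^ 2) (2 * r) r := by
  have h := ((hasDerivAt_id' r).fun_pow 2).add_const (M ^ 2)
  simpa using h

/-- `(R⁴)' = 2R²·2r`. [folklore] -/
theorem hasDerivAt_R4 (M r : ℝ) :
    HasDerivAt (fun x : ℝ ↦ (x ^ 2 + M ^ 2) ^ 2) (2 * (r ^ 2 + M ^ 2) * (2 * r)) r := by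
  have h := (hasDerivAt_R2 M r).fun_pow 2
  simpa using h

/-- The raw derivative of `mzProfileR` (quotient rule, unsimplified). [folklore] -/
def mzProfileR' (M : ℝ) (f f₁ : ℝ → ℝ) : ℝ → ℝ := fun r ↦
  ((f₁ r * (r - M) ^ 2 + f r * (2 * (r - M))) * (r ^ 2 + M ^ 2) - f r * (r - M) ^ 2 * (2 * r)) /
    (r ^ 2 + M ^ 2) ^ 2

/-- The derivative of `mzProfileR` at a point where `f' = f₁`. [folklore] -/
theorem hasDerivAt_mzProfileR (hM : M ≠ 0) {r : ℝ} (hf : HasDerivAt f (f₁ r) r) :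
    HasDerivAt (mzProfileR M f) (mzProfileR' M f f₁ r) r :=
  (hf.fun_mul (hasDerivAt_Delta M r)).fun_div (hasDerivAt_R2 M r) (R2_pos hM r).ne'

/-- `deriv mzProfileR = mzProfileR'` for a globally differentiable seed. [folklore] -/
theorem deriv_mzProfileR (hM : M ≠ 0) (hf : ∀ r, HasDerivAt f (f₁ r) r) :
    deriv (mzProfileR M f) = mzProfileR' M f f₁ :=
  funext fun r ↦ (hasDerivAt_mzProfileR hM (hf r)).deriv

/-- The raw derivative of `mzProfileT` (quotient rule, unsimplified). [folklore] -/
def mzProfileT' (M : ℝ) (f f₁ : ℝ → ℝ) : ℝ → ℝ := fun r ↦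
  ((2 * M * 1 * f r + 2 * M * r * f₁ r) * (r ^ 2 + M ^ 2) - 2 * M * r * f r * (2 * r)) /
    (r ^ 2 + M ^ 2) ^ 2

/-- The derivative of `mzProfileT` at a point where `f' = f₁`. [folklore] -/
theorem hasDerivAt_mzProfileT (hM : M ≠ 0) {r : ℝ} (hf : HasDerivAt f (f₁ r) r) :
    HasDerivAt (mzProfileT M f) (mzProfileT' M f f₁ r) r :=
  ((((hasDerivAt_id' r).const_mul (2 * M)).fun_mul hf).fun_div (hasDerivAt_R2 M r)
    (R2_pos hM r).ne')

/-- `deriv mzProfileT = mzProfileT'` for a globally differentiable seed. [folklore] -/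
theorem deriv_mzProfileT (hM : M ≠ 0) (hf : ∀ r, HasDerivAt f (f₁ r) r) :
    deriv (mzProfileT M f) = mzProfileT' M f f₁ :=
  funext fun r ↦ (hasDerivAt_mzProfileT hM (hf r)).deriv

/-- The raw derivative of `mzProfileW` (product and quotient rules, unsimplified). [folklore] -/
def mzProfileW' (M : ℝ) (f f₁ f₂ : ℝ → ℝ) : ℝ → ℝ := fun r ↦
  (((1 * f r + r * f₁ r) * (r - M) ^ 2 + r * f r * (2 * (r - M))) * (r ^ 2 + M ^ 2) ^ 2 -
      r * f r * (r - M) ^ 2 * (2 * (r ^ 2 + M ^ 2) * (2 * r))) / ((r ^ 2 + M ^ 2) ^ 2) ^ 2 +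
    1 / 2 * ((2 * (r - M) * (r ^ 2 + M ^ 2) - (r - M) ^ 2 * (2 * r)) / (r ^ 2 + M ^ 2) ^ 2 * f₁ r +
      (r - M) ^ 2 / (r ^ 2 + M ^ 2) * f₂ r)

/-- The derivative of `mzProfileW` at a point where `f' = f₁`, `f₁' = f₂`. [folklore] -/
theorem hasDerivAt_mzProfileW (hM : M ≠ 0) {r : ℝ} (hf : HasDerivAt f (f₁ r) r)
    (hf₁ : HasDerivAt f₁ (f₂ r) r) :
    HasDerivAt (mzProfileW M f f₁) (mzProfileW' M f f₁ f₂ r) r := by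
  have hR := (R2_pos hM r).ne'
  have hA := ((((hasDerivAt_id' r).fun_mul hf).fun_mul (hasDerivAt_Delta M r)).fun_div
    (hasDerivAt_R4 M r) (pow_ne_zero 2 hR))
  have hB := (((hasDerivAt_Delta M r).fun_div (hasDerivAt_R2 M r) hR).fun_mul hf₁).const_mul
    (1 / 2 : ℝ)
  exact hA.fun_add hB

/-- `deriv mzProfileW = mzProfileW'` for a globally twice differentiable seed. [folklore] -/
theorem deriv_mzProfileW (hM : M ≠ 0) (hf : ∀ r, HasDerivAt f (f₁ r) r)
    (hf₁ : ∀ r, HasDerivAt f₁ (f₂ r) r) :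
    deriv (mzProfileW M f f₁) = mzProfileW' M f f₁ f₂ :=
  funext fun r ↦ (hasDerivAt_mzProfileW hM (hf r) (hf₁ r)).deriv

end Derivatives

/-! ### The bulk of the Morawetz current: three squares and a zeroth-order term -/

section Bulk

variable {M : ℝ} {f f₁ f₂ f₃ : ℝ → ℝ}

/-- `(R⁸)' = 2R⁴·(R⁴)'`. [folklore] -/
theorem hasDerivAt_R8 (M r : ℝ) :
    HasDerivAt (fun x : ℝ ↦ ((x ^ 2 + M ^ 2) ^ 2) ^ 2)
      (2 * (r ^ 2 + M ^ 2) ^ 2 * (2 * (r ^ 2 + M ^ 2) * (2 * r))) r := by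
  have h := (hasDerivAt_R4 M r).fun_pow 2
  simpa using h

/-- **The bulk of the Morawetz current `f∂_{r*} + ½f'` on axisymmetric functions, extremal Kerr,
as a sum of three squares plus a zeroth-order term** (conventions of
`KerrStarMultiplierIdentity.lean`, `multBulk = −K ρ² sin θ`): for every `G` and every point `q`,
`−multBulk = sin θ [ (f'/R²)(Δ∂_rG + 2Mr∂_{t*}G)² + A ((∂_θG)² + M²(1 − cos²θ)(∂_{t*}G)²) + C G² ]`,
`A = mzAngCoeff`, `C = mzZeroCoeff` — i.e. `K^{X,½f'}[ψ] ρ² = f'(∂_{r*}u)²·(R²/Δ) − ½f∂_{r*}(Δ/R⁴)|Ðu|²·(…) + …`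
with `u = Rψ`, `|Ðu|² = u_θ² + M²sin²θ u_t²`, the physical-space form of the virial identity behind
the `X`-estimates of §8 of the source for the Carter-reduced axisymmetric equation. Proof: the
derivatives of the profiles and `ring`. [cite: Aretakis2012, §8] -/
theorem neg_multBulk_morawetz (hM : M ≠ 0) {G : E4 → ℝ} {q : E4}
    (hf : ∀ᶠ x in 𝓝 (q 1), HasDerivAt f (f₁ x) x) (hf₁ : ∀ᶠ x in 𝓝 (q 1), HasDerivAt f₁ (f₂ x) x)
    (hf₂ : HasDerivAt f₂ (f₃ (q 1)) (q 1)) :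
    -multBulk M M (mzProfileR M f) (mzProfileT M f) (mzProfileW M f f₁) G q =
      sin (q 2) * (f₁ (q 1) / (q 1 ^ 2 + M ^ 2) *
          ((q 1 - M) ^ 2 * pd 1 G q + 2 * M * q 1 * pd 0 G q) ^ 2 +
        mzAngCoeff M f (q 1) * (pd 2 G q ^ 2 + M ^ 2 * (1 - cos (q 2) ^ 2) * pd 0 G q ^ 2) +
        mzZeroCoeff M f f₁ f₂ f₃ (q 1) * G q ^ 2) := by
  set r := q 1 with hr
  have hR := (R2_pos hM r).ne'
  have hf0 : HasDerivAt f (f₁ r) r := hf.self_of_nhds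
  have hf₁0 : HasDerivAt f₁ (f₂ r) r := hf₁.self_of_nhds
  -- first derivatives of the profiles at `r`
  have eR : deriv (mzProfileR M f) r = mzProfileR' M f f₁ r := (hasDerivAt_mzProfileR hM hf0).deriv
  have eT : deriv (mzProfileT M f) r = mzProfileT' M f f₁ r := (hasDerivAt_mzProfileT hM hf0).deriv
  have eW : deriv (mzProfileW M f f₁) r = mzProfileW' M f f₁ f₂ r :=
    (hasDerivAt_mzProfileW hM hf0 hf₁0).deriv
  -- the first derivative of the Lagrangian profile as a function near `r`
  have eWW : deriv (deriv (mzProfileW M f f₁)) r = deriv (mzProfileW' M f f₁ f₂) r := by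
    refine Filter.EventuallyEq.deriv_eq ?_
    filter_upwards [hf, hf₁] with x hx hx₁
    exact (hasDerivAt_mzProfileW hM hx hx₁).deriv
  /- the second derivative of the Lagrangian profile at `r`: differentiate `mzProfileW'` by the
  product and quotient rules, the derivative value being inferred -/
  have hD := hasDerivAt_Delta M r
  have hQ := hasDerivAt_R2 M r
  have hQ2 := hasDerivAt_R4 M r
  have h_sum1 := (hf0.const_mul (1 : ℝ)).fun_add ((hasDerivAt_id' r).fun_mul hf₁0)
  have h_rf := (hasDerivAt_id' r).fun_mul hf0
  have h_2rm := ((hasDerivAt_id' r).sub_const M).const_mul (2 : ℝ)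
  have h_2x := (hasDerivAt_id' r).const_mul (2 : ℝ)
  have h_in := (h_sum1.fun_mul hD).fun_add (h_rf.fun_mul h_2rm)
  have h_big1 := h_in.fun_mul hQ2
  have h_big2 := (h_rf.fun_mul hD).fun_mul ((hQ.const_mul (2 : ℝ)).fun_mul h_2x)
  have h_A := (h_big1.fun_sub h_big2).fun_div (hasDerivAt_R8 M r) (pow_ne_zero 2 (pow_ne_zero 2 hR))
  have h_numB1 := (h_2rm.fun_mul hQ).fun_sub (hD.fun_mul h_2x)
  have h_b1 := (h_numB1.fun_div hQ2 (pow_ne_zero 2 hR)).fun_mul hf₁0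
  have h_b2 := (hD.fun_div hQ hR).fun_mul hf₂
  have h_B := (h_b1.fun_add h_b2).const_mul (1 / 2 : ℝ)
  have h_total := h_A.fun_add h_B
  have e2 : deriv (mzProfileW' M f f₁ f₂) r = _ := h_total.deriv
  -- assemble
  simp only [multBulk, radMultBulk, lagBulk, tFluxR]
  rw [← hr, eWW, e2, eR, eT, eW]
  simp only [mzProfileR, mzProfileR', mzProfileT', mzProfileW, mzProfileW', mzAngCoeff, mzZeroCoeff]
  field_simp
  ring

/-- **The bulk of the Morawetz current has a sign wherever `f' ≥ 0`, `A ≥ 0`, `C ≥ 0`**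
(`θ ∈ [0, π]`): `−multBulk ≥ 0`, with the coercive lower bound of `neg_multBulk_morawetz`.
[cite: Aretakis2012, §8] -/
theorem neg_multBulk_morawetz_nonneg (hM : M ≠ 0) {G : E4 → ℝ} {q : E4}
    (hf : ∀ᶠ x in 𝓝 (q 1), HasDerivAt f (f₁ x) x) (hf₁ : ∀ᶠ x in 𝓝 (q 1), HasDerivAt f₁ (f₂ x) x)
    (hf₂ : HasDerivAt f₂ (f₃ (q 1)) (q 1)) (hθ : q 2 ∈ Icc 0 π)
    (h₁ : 0 ≤ f₁ (q 1)) (hA : 0 ≤ mzAngCoeff M f (q 1)) (hC : 0 ≤ mzZeroCoeff M f f₁ f₂ f₃ (q 1)) :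
    0 ≤ -multBulk M M (mzProfileR M f) (mzProfileT M f) (mzProfileW M f f₁) G q := by
  rw [neg_multBulk_morawetz hM hf hf₁ hf₂]
  have hs : 0 ≤ sin (q 2) := sin_nonneg_of_nonneg_of_le_pi hθ.1 hθ.2
  have hR : 0 < q 1 ^ 2 + M ^ 2 := R2_pos hM (q 1)
  have hcos : 0 ≤ 1 - cos (q 2) ^ 2 := by nlinarith [sin_sq_add_cos_sq (q 2), sq_nonneg (sin (q 2))]
  refine mul_nonneg hs (add_nonneg (add_nonneg ?_ ?_) ?_)
  · exact mul_nonneg (div_nonneg h₁ hR.le) (sq_nonneg _)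
  · exact mul_nonneg hA (add_nonneg (sq_nonneg _)
      (mul_nonneg (mul_nonneg (sq_nonneg _) hcos) (sq_nonneg _)))
  · exact mul_nonneg hC (sq_nonneg _)

/-- **The horizon flux of the Morawetz current**: on `{r = M}` (`Δ = 0`, `f̃(M) = 0`,
`h̃(M) = f(M)`) the total radial flux is `F(t, M, θ) = 2M² f(M) sin θ (∂_{t*}G)²` — signed by `f(M)`
and in absolute value at most `|f(M)|·M` times the horizon `T`-flux `2M sin θ (∂_{t*}G)²`.
[cite: Aretakis2012, §8 and §5.1] -/
theorem multFluxR_morawetz_horizon (hM : M ≠ 0) (G : E4 → ℝ) {q : E4} (hq : q 1 = M) :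
    multFluxR M M (mzProfileR M f) (mzProfileT M f) (mzProfileW M f f₁) G q =
      2 * M ^ 2 * f M * sin (q 2) * pd 0 G q ^ 2 := by
  have hM2 : M ^ 2 + M ^ 2 ≠ 0 := by positivity
  simp only [multFluxR, radMultFluxR, timeMultFluxR, lagFluxR, tFluxR, hq, mzProfileR, mzProfileT,
    sub_self]
  field_simp
  ring

end Bulk

end StarCoord

end Kerr

end Literature.Geometry.Lorentzian

end
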